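import Mathlib
import HarnessLib
import Literature.Probability.MarkovChains.MonotoneSecondEigenfunction
import Literature.Probability.MarkovChains.IsingCycleEigenfunction
import Literature.Probability.MarkovChains.IsingGlauberMonotone
import Literature.Probability.MarkovChains.IsingPositiveCorrelations

/-!
# The second eigenvalue of the ferromagnetic Ising Glauber dynamics on the cycle is `1 − (1 − tanh 2β)/n` (Levin–Peres–Wilmer Example 22.19; equality in Theorem 15.5 (15.15))

HONEST FRAMING: exact (Metropolis-corrected) sampling algorithms for lattice gauge theory; figures
of merit are autocorrelation/cost numbers at stated couplings and volumes; no continuum-physics claim.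

Topic `Probability/MarkovChains`; namespace `Literature.Probability.MarkovChains`.  Vocabulary of
`IsingGlauber.lean` / `GlauberDynamics.lean` (`gibbsLaw G β`, `glauberKernel`),
`IsingCycleEigenfunction.lean` (`magnetisation σ = Σ_i σ(i)`, eq. (15.17) `LevinPeres2017_eq_15_17`:
`PΦ = (1 − (1 − tanh 2β)/n)Φ` on `cycleGraph (n+3)`, and `LevinPeres2017_thm_15_5_gap_le`:
`γ ≤ (1 − tanh 2β)/n`), `SpectralGapVariational.lean` (`secondEigenvalue = λ₂`, `spectralGap = γ =
1 − λ₂`), `MonotoneSecondEigenfunction.lean` (Lemma 22.18), `IsingGlauberMonotone.lean` (Example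
22.2/22.9: the dynamics is monotone for `β ≥ 0`) and `IsingPositiveCorrelations.lean` (Example 22.15:
the Gibbs law has positive correlations for `β ≥ 0`, FKG).  Source: D. A. Levin, Y. Peres (with E. L.
Wilmer), *Markov Chains and Mixing Times*, 2nd ed., AMS 2017 [LevinPeres2017], §22.5 Example 22.19
(p. 314) and §15.3 Theorem 15.5 eq. (15.15).  EVERYTHING IS PROVED (0 named facts).

* `magnetisation_strictMono` — `Φ = Σ_k σ(k)` is strictly increasing for the coordinatewise order
  [cite: LevinPeres2017, §22.5 Example 22.19 with Lemma 22.18 ("If `f = Σ_k g_k` … By Lemma 22.18,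
  the function `f` must be the second eigenfunction")];
* **EXAMPLE 22.19** `LevinPeres2017_example_22_19` — for the Glauber dynamics of the FERROMAGNETIC
  (`β ≥ 0`) Ising model on the `n`-cycle (`n ≥ 3`), **`λ₂ = 1 − (1 − tanh(2β))/n`**; hence
  `LevinPeres2017_example_22_19_gap`: **`γ = (1 − tanh 2β)/n`** and `LevinPeres2017_example_22_19_trel`:
  **`1/γ = n/(1 − tanh(2β))`** [cite: LevinPeres2017, §22.5 Example 22.19 ("`λ₂ = 1 − (1 − tanh(2β))/n`.
  In particular, `t_rel = n/(1 − tanh(2β))`")].  SCOPE (declared): the book's `t_rel` is `1/γ⋆` with the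
  ABSOLUTE gap; typed is `1/γ`, `γ = 1 − λ₂` (the two agree when the dynamics has no eigenvalue below
  `−λ₂`, e.g. for its lazy version; not asserted here).  `β ≥ 0` is needed for monotonicity (Lemma 22.18);
  `IsingCycleEigenfunction.lean`'s one-sided bound holds for every `β`.

Context (cell pub-lqcd, venture LatticeQCDFlow): the exact relaxation rate of single-site heat-bath
for the 1D Ising chain, read off the magnetisation — the slowest mode is the obvious increasing
observable, as Lemma 22.18 guarantees for monotone dynamics.
-/

namespace Literature.Probability.MarkovChains

open Finset Matrix

/-! ## The magnetisation is strictly increasing -/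

section Magnetisation

variable {V : Type*} [Fintype V]

/-- `σ < τ` coordinatewise (some spin strictly raised, none lowered) gives `Σ σ < Σ τ`.
[cite: LevinPeres2017, §22.5 Example 22.19 (the strictly increasing eigenfunction `f = Σ_k σ(k)` fed
to Lemma 22.18)] -/
theorem magnetisation_strictMono : StrictMono (magnetisation : (V → ℤˣ) → ℝ) := by
  intro σ τ hστ
  rw [Pi.lt_def] at hστ
  obtain ⟨hle, i, hi⟩ := hστ
  unfold magnetisation
  refine sum_lt_sum (fun j _ => ?_) ⟨i, mem_univ i, ?_⟩
  · exact_mod_cast Units.val_le_val.mpr (hle j)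
  · exact_mod_cast Units.val_lt_val.mpr hi

end Magnetisation

/-! ## Example 22.19 -/

section Cycle

variable {n : ℕ}

/-- **Example 22.19 (Ising on the `n`-cycle).**  For `β ≥ 0` the second eigenvalue of the Glauber
dynamics of the Ising model on the cycle `ℤ/nℤ` (`n ≥ 3`) is `λ₂ = 1 − (1 − tanh(2β))/n`: the
magnetisation is a strictly increasing eigenfunction with this eigenvalue (eq. (15.17)), the dynamics is
monotone and its Gibbs law has positive correlations, so Lemma 22.18 applies.
[cite: LevinPeres2017, §22.5 Example 22.19] -/
theorem LevinPeres2017_example_22_19 {β : ℝ} (hβ : 0 ≤ β) :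
    secondEigenvalue (gibbsLaw (SimpleGraph.cycleGraph (n + 3)) β)
        (glauberKernel (gibbsLaw (SimpleGraph.cycleGraph (n + 3)) β)) =
      1 - (1 - Real.tanh (2 * β)) / (n + 3 : ℝ) := by
  set G := SimpleGraph.cycleGraph (n + 3)
  haveI : Nontrivial (Fin (n + 3) → ℤˣ) :=
    ⟨⟨fun _ => 1, fun _ => -1, fun e => units_ne_neg_self (1 : ℤˣ) (congrFun e 0)⟩⟩
  have hmono : ∀ f : (Fin (n + 3) → ℤˣ) → ℝ, Monotone f →
      Monotone (glauberKernel (gibbsLaw G β) *ᵥ f) :=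
    fun f hf => isingGlauber_monotone (G := G) hβ f hf
  have hpc : ∀ φ ψ : (Fin (n + 3) → ℤˣ) → ℝ, Monotone φ → Monotone ψ →
      (∑ x, gibbsLaw G β x * φ x) * (∑ x, gibbsLaw G β x * ψ x) ≤
        ∑ x, gibbsLaw G β x * (φ x * ψ x) :=
    fun φ ψ hφ hψ => LevinPeres2017_example_22_15 (G := G) hβ φ ψ hφ hψ
  exact (LevinPeres2017_lemma_22_18 (gibbsLaw_pos (G := G) β) (sum_gibbsLaw (G := G) β)
    (glauberKernel_isRowStochastic (gibbsLaw_pos (G := G) β)) (isingGlauber_detailedBalance (G := G) β)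
    hmono hpc magnetisation_strictMono (LevinPeres2017_eq_15_17 (n := n) β)).symm

/-- **Equality in (15.15): `γ = (1 − tanh 2β)/n = c_O(β)/n`** for the ferromagnetic Ising Glauber
dynamics on the `n`-cycle (`n ≥ 3`, `β ≥ 0`). [cite: LevinPeres2017, §22.5 Example 22.19 with §15.3
Thm 15.5 eq. (15.15)] -/
theorem LevinPeres2017_example_22_19_gap {β : ℝ} (hβ : 0 ≤ β) :
    spectralGap (gibbsLaw (SimpleGraph.cycleGraph (n + 3)) β)
        (glauberKernel (gibbsLaw (SimpleGraph.cycleGraph (n + 3)) β)) =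
      (1 - Real.tanh (2 * β)) / (n + 3 : ℝ) := by
  unfold spectralGap
  rw [LevinPeres2017_example_22_19 (n := n) hβ]
  ring

/-- `1/γ = n/(1 − tanh(2β))` ("In particular, `t_rel = n/(1 − tanh(2β))`", with `t_rel` read as
`1/γ`, see the file header). [cite: LevinPeres2017, §22.5 Example 22.19] -/
theorem LevinPeres2017_example_22_19_trel {β : ℝ} (hβ : 0 ≤ β) :
    1 / spectralGap (gibbsLaw (SimpleGraph.cycleGraph (n + 3)) β)
        (glauberKernel (gibbsLaw (SimpleGraph.cycleGraph (n + 3)) β)) =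
      (n + 3 : ℝ) / (1 - Real.tanh (2 * β)) := by
  rw [LevinPeres2017_example_22_19_gap (n := n) hβ, one_div, inv_div]

end Cycle

end Literature.Probability.MarkovChains
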